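import Summits.Ventures.DiscreteObjects.MOLS.I5Census
import Literature.Combinatorics.Designs.MannSubsquareObstruction

/-!
# Target (M-a) typed: three MOLS of order 10, in both vocabularies of the cell (kernel glue)
Framing: lottery ticket; floor = certified bounds/negative ranges.

Cell pub-namedobj (venture DiscreteObjects), target (M), designs gen 9.  The cell uses two (equivalent) formalisations of 'Latin'
and 'orthogonal': `MOLS.IsLatin` / `MOLS.Orthogonal` (`CyclicQuasigroupMOLS`, family C5, p206399) and the Literature predicates
`LatinSquares.IsLatinSquare` / `IsOrthogonalMate` (Mann file, p285176; used by the floor facts and by `FiveMOLS12`, `PlaneOfMOLS`).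
This file proves they agree (`isLatin_iff`, `orthogonal_iff`), TYPES the census target (M-a) — **`ExistsThreeMOLS10`**: three
pairwise orthogonal Latin squares of order 10 (OPEN; `2 ≤ N(10) ≤ 6` in print) — once in each vocabulary with the equivalence
(`existsThreeMOLS10_iff`), records that both predicates are decidable on explicit squares (a HIT would be certified by `decide`),
and restates the family-C5 HIT route: an `I5` Latin square of order 10 would give a witness (`existsThreeMOLS10_of_I5`).
No new mathematics; typing/glue only; no `sorry`.
-/

namespace Summit.Ventures.DiscreteObjects.MOLS

open Function Literature.Combinatorics.Designs.LatinSquares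

variable {α : Type*}

/-- the two 'Latin' predicates agree -/
theorem isLatin_iff (L : α → α → α) : IsLatin L ↔ IsLatinSquare L := by
  constructor
  · rintro ⟨hr, hc⟩
    exact ⟨fun x => fun y y' h => hr x y y' h, fun y => fun x x' h => hc y x x' h⟩
  · rintro ⟨hr, hc⟩
    exact ⟨fun x y y' h => hr x h, fun y x x' h => hc y h⟩

/-- the two 'orthogonal' predicates agree -/
theorem orthogonal_iff (A B : α → α → α) : Orthogonal A B ↔ IsOrthogonalMate A B := by
  constructor
  · intro h
    rintro ⟨x, y⟩ ⟨x', y'⟩ hpq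
    simp only [Prod.mk.injEq] at hpq
    obtain ⟨hx, hy⟩ := h x y x' y' hpq.1 hpq.2
    exact Prod.ext hx hy
  · intro h x y x' y' hA hB
    have e := @h (x, y) (x', y') (Prod.ext hA hB)
    simp only [Prod.mk.injEq] at e
    exact e

/-- **Census target (M-a), typed (OPEN):** there are three mutually orthogonal Latin squares of order 10. -/
def ExistsThreeMOLS10 : Prop :=
  ∃ L : Fin 3 → Fin 10 → Fin 10 → Fin 10,
    (∀ k, IsLatinSquare (L k)) ∧ ∀ k k', k ≠ k' → IsOrthogonalMate (L k) (L k')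

/-- the same target in the family-C5 vocabulary -/
def ExistsThreeMOLS10' : Prop :=
  ∃ L₁ L₂ L₃ : Fin 10 → Fin 10 → Fin 10, IsLatin L₁ ∧ IsLatin L₂ ∧ IsLatin L₃ ∧
    Orthogonal L₁ L₂ ∧ Orthogonal L₁ L₃ ∧ Orthogonal L₂ L₃

/-- orthogonality is symmetric (Literature vocabulary) -/
theorem isOrthogonalMate_symm {A B : α → α → α} (h : IsOrthogonalMate A B) : IsOrthogonalMate B A := by
  intro p q hpq
  simp only [Prod.mk.injEq] at hpq
  exact h (Prod.ext hpq.2 hpq.1)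

/-- **The two typings of the target agree.** -/
theorem existsThreeMOLS10_iff : ExistsThreeMOLS10 ↔ ExistsThreeMOLS10' := by
  constructor
  · rintro ⟨L, hL, hO⟩
    refine ⟨L 0, L 1, L 2, (isLatin_iff _).2 (hL 0), (isLatin_iff _).2 (hL 1), (isLatin_iff _).2 (hL 2),
      (orthogonal_iff _ _).2 (hO 0 1 (by decide)), (orthogonal_iff _ _).2 (hO 0 2 (by decide)),
      (orthogonal_iff _ _).2 (hO 1 2 (by decide))⟩
  · rintro ⟨L₁, L₂, L₃, h₁, h₂, h₃, h₁₂, h₁₃, h₂₃⟩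
    refine ⟨![L₁, L₂, L₃], ?_, ?_⟩
    · intro k
      fin_cases k
      · exact (isLatin_iff _).1 h₁
      · exact (isLatin_iff _).1 h₂
      · exact (isLatin_iff _).1 h₃
    · intro k k' hkk
      fin_cases k <;> fin_cases k'
      · exact absurd rfl hkk
      · exact (orthogonal_iff _ _).1 h₁₂
      · exact (orthogonal_iff _ _).1 h₁₃
      · exact isOrthogonalMate_symm ((orthogonal_iff _ _).1 h₁₂)
      · exact absurd rfl hkk
      · exact (orthogonal_iff _ _).1 h₂₃
      · exact isOrthogonalMate_symm ((orthogonal_iff _ _).1 h₁₃)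
      · exact isOrthogonalMate_symm ((orthogonal_iff _ _).1 h₂₃)
      · exact absurd rfl hkk

/-- the target predicate is decidable on explicit squares (a HIT is a `decide`) -/
instance decIsLatinSquare {m : ℕ} (L : Fin m → Fin m → Fin m) : Decidable (IsLatinSquare L) := by
  unfold IsLatinSquare Injective; infer_instance

/-- orthogonality is decidable on explicit squares -/
instance decIsOrthogonalMate {m : ℕ} (L M : Fin m → Fin m → Fin m) : Decidable (IsOrthogonalMate L M) := by
  unfold IsOrthogonalMate Injective; infer_instance

/-- **The family-C5 HIT route, retyped:** a Latin square of order 10 satisfying the pentagonal identity `I5` would give three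
MOLS(10) (`three_MOLS_of_I5_counterexample`, `I5Census`). -/
theorem existsThreeMOLS10_of_I5 (mul : Fin 10 → Fin 10 → Fin 10) (hL : IsLatin mul) (h5 : IdentityI5 mul) :
    ExistsThreeMOLS10 := by
  obtain ⟨h₁, h₂, h₃, h₁₂, h₁₃, h₂₃⟩ := three_MOLS_of_I5_counterexample mul hL h5
  exact existsThreeMOLS10_iff.2 ⟨_, _, _, h₁, h₂, h₃, h₁₂, h₁₃, h₂₃⟩

end Summit.Ventures.DiscreteObjects.MOLS
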